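import Literature.MathematicalPhysics.QuantumFieldTheory.SUNBakryEmeryFisher
import HarnessLib

/-!
# `L²` decay and the entropy–variance bound along the polynomial heat flow on `SU(N)`

Fourth file of the dynamic Bakry–Émery argument for the Haar probability measure `σ` of `SU(N)` (Bakry–Gentil–Ledoux 2014,
Thm. 4.2.5 and Prop. 5.7.1, proof p. 268–269), preparing the limiting step `Ent_σ(P_T f) → 0`:

* `Gam_sub_const_left`, `Gam_sq_add_const` — `Γ(F − m, G) = Γ(F,G)`, `Γ(u²+ε, u²+ε) = 4u²Γ(u,u)`;
* `entropy_le_variance_div` — `Ent_σ(f) ≤ Var_σ(f)/∫f` for continuous `f > 0` (`log x ≤ x − 1`);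
* `hasDerivAt_variance_flow` — `d/dt ∫ (p_t − m)² dσ = −2∫ Γ(p_t,p_t) dσ` (BGL (4.2.2));
* `variance_flow_le` — `∫ (p_t − m)² dσ ≤ e^{−Nt} ∫ (p_0 − m)² dσ`, `m = ∫ p_0 dσ`, from the Poincaré inequality
  `(N/2)Var_σ ≤ ∫Γ` (`poincare_haar`) and conservation of mass (BGL Thm. 4.2.5 (i)⇒(ii) on the finite-dimensional model).

Theorems only; no definition.  The log-Sobolev inequality is assembled in `SUNBakryEmeryLogSobolev.lean`.

## References

* D. Bakry, I. Gentil, M. Ledoux, *Analysis and Geometry of Markov Diffusion Operators*, Grundlehren 348 (2014),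
  Thm. 4.2.5 with (4.2.2), Prop. 5.7.1 (proof, p. 268).
-/

noncomputable section

open scoped Matrix ComplexConjugate BigOperators

namespace Literature.MathematicalPhysics.QuantumFieldTheory

namespace SUNBakryEmery

open scoped Matrix.Norms.Frobenius ContDiff Topology
open Matrix Complex Finset MeasureTheory Filter Set Metric

variable {N : ℕ}

/-! ### Small identities -/

/-- `Γ(F − m, G) = Γ(F, G)` for a constant `m`. [cite: BakryGentilLedoux2014, Thm. 4.2.5 (proof device)] -/
theorem Gam_sub_const_left {F G : Matrix (Fin N) (Fin N) ℂ → ℝ} (hF : ContDiff ℝ ∞ F) (m : ℝ)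
    (Q : Matrix (Fin N) (Fin N) ℂ) : Gam (fun Q => F Q - m) G Q = Gam F G Q := by
  simp only [Gam]
  refine sum_congr rfl fun α _ => ?_
  have h : matD (frame α) (fun Q => F Q - m) = matD (frame α) F := by
    have e : (fun Q => F Q - m) = F - fun _ => m := by funext Q; simp
    rw [e, matD_sub hF contDiff_const, matD_const]
    simp
  rw [h]

/-- `Γ(u² + ε, u² + ε) = 4 u² Γ(u,u)`. [cite: BakryGentilLedoux2014, Prop. 5.7.1 (change f ↦ f²; proof device)] -/
theorem Gam_sq_add_const {u : Matrix (Fin N) (Fin N) ℂ → ℝ} (hu : ContDiff ℝ ∞ u) (ε : ℝ)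
    (Q : Matrix (Fin N) (Fin N) ℂ) :
    Gam (fun Q => u Q ^ 2 + ε) (fun Q => u Q ^ 2 + ε) Q = 4 * u Q ^ 2 * Gam u u Q := by
  have hψ : ContDiff ℝ ∞ (fun x : ℝ => x ^ 2 + ε) := (contDiff_id.pow 2).add contDiff_const
  have hd : ∀ x : ℝ, deriv (fun x : ℝ => x ^ 2 + ε) x = 2 * x := by
    intro x
    have : HasDerivAt (fun x : ℝ => x ^ 2 + ε) (2 * x) x := by
      simpa using ((hasDerivAt_id x).pow 2).add_const ε
    exact this.deriv
  have e1 := Gam_comp_left hu hψ (G := fun Q => u Q ^ 2 + ε) Q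
  have e2 : Gam u (fun Q => u Q ^ 2 + ε) Q = Gam (fun Q => u Q ^ 2 + ε) u Q := by rw [Gam_comm]
  have e3 := Gam_comp_left hu hψ (G := u) Q
  rw [e1, e2, e3, hd]
  ring

/-- **`Ent_σ(f) ≤ Var_σ(f)/m`** for a continuous `f > 0` on `SU(N)` with mean `m = ∫ f dσ`:
`∫ f log f − m log m ≤ (∫ (f − m)²)/m` (from `log(x/m) ≤ x/m − 1`).  Gives `Ent(P_t f) → 0` from the `L²` convergence
of the semigroup (BGL use ergodicity, §1.8, for the same purpose). [cite: BakryGentilLedoux2014, Prop. 5.7.1 (proof p. 268, limiting procedure)] -/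
theorem entropy_le_variance_div {f : SUN N → ℝ} (hf : Continuous f) (hpos : ∀ g, 0 < f g)
    (hm : 0 < ∫ g, f g ∂(haarSU N)) :
    ∫ g, f g * Real.log (f g) ∂(haarSU N) - (∫ g, f g ∂(haarSU N)) * Real.log (∫ g, f g ∂(haarSU N)) ≤
      (∫ g, (f g - ∫ g', f g' ∂(haarSU N)) ^ 2 ∂(haarSU N)) / ∫ g, f g ∂(haarSU N) := by
  set σ := haarSU N
  set m := ∫ g, f g ∂σ with hm_def
  have hI : ∀ {φ : SUN N → ℝ}, Continuous φ → Integrable φ σ := fun h => integrable_of_continuous_SUN h _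
  -- pointwise: `x log x ≤ x log m + (x − m) + (x − m)²/m`
  have hpt : ∀ g, f g * Real.log (f g) ≤ f g * Real.log m + (f g - m) + (f g - m) ^ 2 / m := by
    intro g
    have hx := hpos g
    have h1 : Real.log (f g / m) ≤ f g / m - 1 := Real.log_le_sub_one_of_pos (div_pos hx hm)
    rw [Real.log_div hx.ne' hm.ne'] at h1
    have h2 := mul_le_mul_of_nonneg_left h1 hx.le
    have e : f g * Real.log m + (f g - m) + (f g - m) ^ 2 / m = f g * Real.log m + f g * (f g / m - 1) := by
      field_simp
      ring
    rw [e]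
    linarith
  have i0 : Integrable (fun g => f g * Real.log (f g)) σ := hI (hf.mul (hf.log fun g => (hpos g).ne'))
  have i1 : Integrable (fun g => f g * Real.log m) σ := hI (hf.mul continuous_const)
  have i2 : Integrable (fun g => f g - m) σ := hI (hf.sub continuous_const)
  have i3 : Integrable (fun g => (f g - m) ^ 2 / m) σ := hI (((hf.sub continuous_const).pow 2).div_const m)
  have i12 : Integrable (fun g => f g * Real.log m + (f g - m)) σ := i1.add i2
  have i123 : Integrable (fun g => f g * Real.log m + (f g - m) + (f g - m) ^ 2 / m) σ := i12.add i3
  have hint := integral_mono i0 i123 hpt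
  have e : ∫ g, (f g * Real.log m + (f g - m) + (f g - m) ^ 2 / m) ∂σ = m * Real.log m + (∫ g, (f g - m) ^ 2 ∂σ) / m := by
    rw [integral_add i12 i3, integral_add i1 i2, integral_mul_const, integral_sub (hI hf) (integrable_const m),
      integral_const]
    simp only [smul_eq_mul, probReal_univ, one_mul, ← hm_def, sub_self, add_zero]
    rw [integral_div]
  have hint' : ∫ g, f g * Real.log (f g) ∂σ ≤ m * Real.log m + (∫ g, (f g - m) ^ 2 ∂σ) / m := by
    refine hint.trans (le_of_eq ?_)
    rw [← e]
  linarith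

/-! ### `L²` decay along the polynomial heat flow -/

/-- **`d/dt ∫ (p_t − m)² dσ = −2 ∫ Γ(p_t,p_t) dσ`** along a polynomial heat flow (BGL (4.2.2):
`d/dt Var(P_t f) = −2ℰ(P_t f)`). [cite: BakryGentilLedoux2014, Thm. 4.2.5 (4.2.2)] -/
theorem hasDerivAt_variance_flow (hN : N ≠ 0) {d : ℕ} {b : Fin d → Matrix (Fin N) (Fin N) ℂ → ℝ}
    (hb : ∀ i, ContDiff ℝ ∞ (b i)) {c c' : ℝ → Fin d → ℝ} (hc : ∀ t i, HasDerivAt (fun s => c s i) (c' t i) t)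
    (hc' : ∀ i, Continuous fun t => c' t i)
    (hheat : ∀ t, Lap (fun Q => ∑ i, c t i * b i Q) = fun Q => ∑ i, c' t i * b i Q) (m t₀ : ℝ) :
    HasDerivAt (fun t => ∫ g : SUN N, (∑ i, c t i * b i (g : Matrix (Fin N) (Fin N) ℂ) - m) ^ 2 ∂(haarSU N))
      (-2 * ∫ g : SUN N, Gam (fun Q => ∑ i, c t₀ i * b i Q) (fun Q => ∑ i, c t₀ i * b i Q) g ∂(haarSU N)) t₀ := by
  set P : ℝ → SUN N → ℝ := fun t g => ∑ i, c t i * b i (g : Matrix (Fin N) (Fin N) ℂ) with hP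
  set LP : ℝ → SUN N → ℝ := fun t g => ∑ i, c' t i * b i (g : Matrix (Fin N) (Fin N) ℂ) with hLP
  have hcc : ∀ i, Continuous fun t => c t i := continuous_coeff_of_hasDerivAt hc
  have hbc : ∀ i, Continuous fun g : SUN N => b i (g : Matrix (Fin N) (Fin N) ℂ) :=
    fun i => continuous_restrict (hb i)
  have hPc : Continuous (Function.uncurry P) := continuous_sum_mul_uncurry hcc hbc
  have hLPc : Continuous (Function.uncurry LP) := continuous_sum_mul_uncurry hc' hbc
  have hmain := hasDerivAt_integral_SUN (N := N) (t₀ := t₀) zero_lt_one (F := fun t g => (P t g - m) ^ 2)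
    (F' := fun t g => 2 * (P t g - m) * LP t g) ?_ ?_ ?_
  rotate_left
  · intro t _
    exact ((hPc.comp (Continuous.prodMk_right t)).sub continuous_const).pow 2
  · exact (((hPc.sub continuous_const).const_mul 2).mul hLPc).continuousOn
  · intro t _ g
    have h1 : HasDerivAt (fun s => P s g) (LP t g) t := hasDerivAt_flow_apply b hc t (g : Matrix (Fin N) (Fin N) ℂ)
    have h2 := (h1.sub_const m).pow 2
    refine h2.congr_deriv ?_
    simp only [Nat.cast_ofNat]
    ring
  -- value: `∫ 2(p − m) Δp = −2 ∫ Γ(p,p)`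
  have hPs : ContDiff ℝ ∞ (fun Q => ∑ i, c t₀ i * b i Q) := contDiff_sum_mul hb (c t₀)
  have hval : ∫ g : SUN N, 2 * (P t₀ g - m) * LP t₀ g ∂(haarSU N) =
      -2 * ∫ g : SUN N, Gam (fun Q => ∑ i, c t₀ i * b i Q) (fun Q => ∑ i, c t₀ i * b i Q) g ∂(haarSU N) := by
    have h := integral_mul_Lap hN (F := fun Q => (∑ i, c t₀ i * b i Q) - m) (hPs.sub contDiff_const) hPs
    rw [hheat t₀] at h
    have e1 : ∀ g : SUN N, 2 * (P t₀ g - m) * LP t₀ g =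
        2 * ((fun Q => (∑ i, c t₀ i * b i Q) - m) (g : Matrix (Fin N) (Fin N) ℂ) *
          (fun Q => ∑ i, c' t₀ i * b i Q) (g : Matrix (Fin N) (Fin N) ℂ)) := fun g => by
      simp only [hP, hLP]; ring
    simp_rw [e1]
    rw [integral_const_mul, h]
    simp_rw [Gam_sub_const_left hPs]
    ring
  exact hmain.congr_deriv hval

/-- **`L²` decay along the heat flow**: `∫ (p_t − m)² dσ ≤ e^{−Nt} ∫ (p_0 − m)² dσ` for `t ≥ 0`, `m = ∫ p_0 dσ`, from the
Poincaré inequality `(N/2)Var_σ ≤ ∫Γ` (`poincare_haar`) and `∫ p_t = m` (BGL Thm. 4.2.5 (i)⇒(ii): `Var(P_t f) ≤ e^{−2t/C}Var(f)`).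
[cite: BakryGentilLedoux2014, Thm. 4.2.5] -/
theorem variance_flow_le (hN : N ≠ 0) {d : ℕ} {b : Fin d → Matrix (Fin N) (Fin N) ℂ → ℝ}
    (hb : ∀ i, ContDiff ℝ ∞ (b i)) {c c' : ℝ → Fin d → ℝ} (hc : ∀ t i, HasDerivAt (fun s => c s i) (c' t i) t)
    (hc' : ∀ i, Continuous fun t => c' t i)
    (hheat : ∀ t, Lap (fun Q => ∑ i, c t i * b i Q) = fun Q => ∑ i, c' t i * b i Q) {t : ℝ} (ht : 0 ≤ t) :
    ∫ g : SUN N, (∑ i, c t i * b i (g : Matrix (Fin N) (Fin N) ℂ) -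
        ∫ g', ∑ i, c 0 i * b i (g' : Matrix (Fin N) (Fin N) ℂ) ∂(haarSU N)) ^ 2 ∂(haarSU N) ≤
      Real.exp (-(N : ℝ) * t) * ∫ g : SUN N, (∑ i, c 0 i * b i (g : Matrix (Fin N) (Fin N) ℂ) -
        ∫ g', ∑ i, c 0 i * b i (g' : Matrix (Fin N) (Fin N) ℂ) ∂(haarSU N)) ^ 2 ∂(haarSU N) := by
  set m := ∫ g' : SUN N, ∑ i, c 0 i * b i (g' : Matrix (Fin N) (Fin N) ℂ) ∂(haarSU N) with hm
  set V : ℝ → ℝ := fun s => ∫ g : SUN N, (∑ i, c s i * b i (g : Matrix (Fin N) (Fin N) ℂ) - m) ^ 2 ∂(haarSU N) with hV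
  -- `V' = −2∫Γ ≤ −N V`
  have hderiv : ∀ s, HasDerivAt V (-2 * ∫ g : SUN N, Gam (fun Q => ∑ i, c s i * b i Q)
      (fun Q => ∑ i, c s i * b i Q) g ∂(haarSU N)) s :=
    fun s => hasDerivAt_variance_flow hN hb hc hc' hheat m s
  have hmass : ∀ s, ∫ g : SUN N, ∑ i, c s i * b i (g : Matrix (Fin N) (Fin N) ℂ) ∂(haarSU N) = m :=
    fun s => polyFlow_integral_eq hN hb hc hheat s
  have hpoinc : ∀ s, (N : ℝ) / 2 * V s ≤ ∫ g : SUN N, Gam (fun Q => ∑ i, c s i * b i Q)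
      (fun Q => ∑ i, c s i * b i Q) g ∂(haarSU N) := by
    intro s
    have h := poincare_haar hN (contDiff_sum_mul hb (c s))
    rw [hmass s] at h
    exact h
  -- `W(s) = e^{Ns} V(s)` is non-increasing on `[0, ∞)`
  set W : ℝ → ℝ := fun s => Real.exp ((N : ℝ) * s) * V s with hW
  have hWd : ∀ s, HasDerivAt W (Real.exp ((N : ℝ) * s) * ((N : ℝ) * V s + -2 * ∫ g : SUN N,
      Gam (fun Q => ∑ i, c s i * b i Q) (fun Q => ∑ i, c s i * b i Q) g ∂(haarSU N))) s := by
    intro s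
    have he : HasDerivAt (fun s => Real.exp ((N : ℝ) * s)) (Real.exp ((N : ℝ) * s) * N) s := by
      have := ((hasDerivAt_id s).const_mul (N : ℝ)).exp
      simpa using this
    have h := he.mul (hderiv s)
    refine h.congr_deriv ?_
    ring
  have hanti : AntitoneOn W (Ici 0) := by
    refine antitoneOn_of_deriv_nonpos (convex_Ici 0) (fun s _ => (hWd s).continuousAt.continuousWithinAt)
      (fun s _ => (hWd s).differentiableAt.differentiableWithinAt) fun s _ => ?_
    rw [(hWd s).deriv]
    have := hpoinc s
    exact mul_nonpos_of_nonneg_of_nonpos (Real.exp_pos _).le (by linarith)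
  have h := hanti (mem_Ici.2 le_rfl) (mem_Ici.2 ht) ht
  simp only [hW, mul_zero, Real.exp_zero, one_mul] at h
  -- `e^{Nt} V t ≤ V 0` ⇒ `V t ≤ e^{−Nt} V 0`
  have hexp : Real.exp (-(N : ℝ) * t) * Real.exp ((N : ℝ) * t) = 1 := by
    rw [← Real.exp_add]; simp
  calc V t = Real.exp (-(N : ℝ) * t) * (Real.exp ((N : ℝ) * t) * V t) := by
        rw [← mul_assoc, hexp, one_mul]
    _ ≤ Real.exp (-(N : ℝ) * t) * V 0 := mul_le_mul_of_nonneg_left h (Real.exp_pos _).le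

end SUNBakryEmery

end Literature.MathematicalPhysics.QuantumFieldTheory
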